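import Mathlib
import Summits.CriticalPhenomena.PercolationContinuityZ3.Theorems.PercNearOneGluingNoHeavyQuantTwoArcExpect
import HarnessLib

/-!
# QUANT lane R8, "FAR beyond trees", layer one on hairy cycles — hair-pattern weights over an index set vs. the indexed expectation ((D0), pattern side)

builds on p205010 (kernel theorem, internal audit signed; external expert review pending)

Support file (`--supports stmt-CriticalPhenomena-4575`), seat `prim-quant-p1` (gen 17); `quant/prim-quant-p1-g17/FOR-PROVERS-TWOARC-BRIDGE.md` §2–§3
(division of labour with prim-cert-1 g20, INBOX 23:28Z: prim-cert-1 does the law side — conditioning on the open hairs (S1), arc sums (S2, landed as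
`…QuantFarSunArcSums`), the middle-position lemma (S3); this file is p1's (D0): matching the powerset sum over hair patterns with `expect2`).
* `patW S w Q = ∏_{k∈S} (w k if k ∈ Q else 1 − w k)` — prim-cert-1's `hairW K h Q` is `patW (range K) h Q` by definition;
* `expect_congr` (only hair weights matter), **`sum_patW_eq_expect`** (duplicate-free index list: `Σ_{Q ⊆ ks} patW·G = expect f ks (G ∘ toFinset)`,
  by `Finset.sum_powerset_insert`), **`sum_patW_sure`** (a sure index `a`: only patterns `insert a Q'` weigh), `leftIdx a = [a−1,…,0]`,
  `rightIdx K a = [a+1,…,K−1]`, `leftIdx_append_rightIdx` (they enumerate `range K ∖ a` without repetition);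
* **`sum_patW_range_eq_expect2`** — for `w a = 1`, `a < K`, any `G`:
  `Σ_{Q ⊆ range K} patW (range K) w Q · G Q = expect2 fL fR (leftIdx a) (rightIdx K a) (fun Q_L Q_R => G (insert a (Q_L ++ Q_R).toFinset))`
  for any companion data `fL, fR : ℕ → HComp` carrying the hair weights on the respective sides.
With (S1) this turns `sunLaw K g h (2 ≤ #·)` (sure distinguished tip `a`) into `expect2` of `Ψ(Q_L,Q_R) = sunLaw K g 1 (2 ≤ #((insert a …) ∩ ·))`,
to which `expect2_nonneg` (`…QuantTwoArcExpect`) applies once (S2)/(S3) identify the small-pattern values.  Pure finite algebra; new definitions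
`patW`, `leftIdx`, `rightIdx`; standard axioms; no sorries. [this work]
-/

namespace Summit.CriticalPhenomena.PercolationContinuityZ3.Theorems

namespace Quant

namespace TwoArc

open Finset

variable {ι : Type*} [DecidableEq ι]

/-! ## Hair-pattern weights over a finite index set, and their match with `expect` -/

/-- Pattern weight over a finite index set `S`: `patW S w Q = ∏_{k ∈ S} (w k if k ∈ Q else 1 − w k)` (prim-cert-1's `hairW K h Q` is
`patW (range K) h Q`). [this work] -/
def patW (S : Finset ι) (w : ι → ℝ) (Q : Finset ι) : ℝ := ∏ k ∈ S, if k ∈ Q then w k else 1 - w k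

omit [DecidableEq ι] in
/-- `expect` only reads the hair weights of the data. [this work] -/
theorem expect_congr {f f' : ι → HComp} {ks : List ι} (h : ∀ k ∈ ks, (f k).h = (f' k).h) (Ψ : List ι → ℝ) :
    expect f ks Ψ = expect f' ks Ψ := by
  induction ks generalizing Ψ with
  | nil => simp
  | cons k ks ih =>
    simp only [expect_cons, h k (by simp), ih (fun l hl => h l (by simp [hl]))]

/-- **Powerset sum = expectation over the pattern**: for a duplicate-free index list `ks` and weights `w` with `(f k).h = w k`,
`Σ_{Q ⊆ ks.toFinset} patW ks.toFinset w Q · G Q = expect f ks (G ∘ toFinset)`. [this work] -/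
theorem sum_patW_eq_expect (f : ι → HComp) (w : ι → ℝ) (G : Finset ι → ℝ) :
    ∀ (ks : List ι), ks.Nodup → (∀ k ∈ ks, (f k).h = w k) →
      ∑ Q ∈ ks.toFinset.powerset, patW ks.toFinset w Q * G Q = expect f ks (fun Q => G Q.toFinset) := by
  intro ks
  induction ks generalizing G with
  | nil => intro _ _; simp [patW]
  | cons k ks ih =>
    intro hnd hw
    rw [List.nodup_cons] at hnd
    have hk : k ∉ ks.toFinset := by simpa using hnd.1
    have hwk : (f k).h = w k := hw k (by simp)
    rw [List.toFinset_cons, Finset.sum_powerset_insert hk, expect_cons]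
    -- the two partial sums
    have hA : ∑ Q ∈ ks.toFinset.powerset, patW (insert k ks.toFinset) w Q * G Q
        = (1 - w k) * ∑ Q ∈ ks.toFinset.powerset, patW ks.toFinset w Q * G Q := by
      rw [Finset.mul_sum]
      refine Finset.sum_congr rfl fun Q hQ => ?_
      rw [Finset.mem_powerset] at hQ
      have hkQ : k ∉ Q := fun h => hk (hQ h)
      simp only [patW]
      rw [Finset.prod_insert hk, if_neg hkQ]
      ring
    have hB : ∑ Q ∈ ks.toFinset.powerset, patW (insert k ks.toFinset) w (insert k Q) * G (insert k Q)
        = w k * ∑ Q ∈ ks.toFinset.powerset, patW ks.toFinset w Q * G (insert k Q) := by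
      rw [Finset.mul_sum]
      refine Finset.sum_congr rfl fun Q hQ => ?_
      rw [Finset.mem_powerset] at hQ
      have hprod : ∏ j ∈ ks.toFinset, (if j ∈ insert k Q then w j else 1 - w j) = ∏ j ∈ ks.toFinset, (if j ∈ Q then w j else 1 - w j) := by
        refine Finset.prod_congr rfl fun j hj => ?_
        have hjk : j ≠ k := fun h => hk (h ▸ hj)
        simp [Finset.mem_insert, hjk]
      simp only [patW]
      rw [Finset.prod_insert hk, if_pos (Finset.mem_insert_self k Q), hprod]
      ring
    rw [hA, hB, ih G hnd.2 (fun l hl => hw l (by simp [hl])),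
      ih (fun Q => G (insert k Q)) hnd.2 (fun l hl => hw l (by simp [hl])), hwk]
    simp only [List.toFinset_cons]
    ring

/-- With a SURE distinguished index `a ∈ S` (`w a = 1`) only patterns containing `a` weigh: `Σ_{Q ⊆ S} patW S w Q · G Q =
Σ_{Q' ⊆ S ∖ a} patW (S ∖ a) w Q' · G (insert a Q')`. [this work] -/
theorem sum_patW_sure (S : Finset ι) (w : ι → ℝ) (G : Finset ι → ℝ) {a : ι} (ha : a ∈ S) (hwa : w a = 1) :
    ∑ Q ∈ S.powerset, patW S w Q * G Q = ∑ Q ∈ (S.erase a).powerset, patW (S.erase a) w Q * G (insert a Q) := by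
  have hS : S = insert a (S.erase a) := (Finset.insert_erase ha).symm
  have hna : a ∉ S.erase a := Finset.notMem_erase a S
  conv_lhs => rw [hS]
  rw [Finset.sum_powerset_insert hna]
  have h0 : ∑ Q ∈ (S.erase a).powerset, patW (insert a (S.erase a)) w Q * G Q = 0 := by
    refine Finset.sum_eq_zero fun Q hQ => ?_
    rw [Finset.mem_powerset] at hQ
    have haQ : a ∉ Q := fun h => hna (hQ h)
    simp [patW, Finset.prod_insert hna, haQ, hwa]
  rw [h0, zero_add]
  refine Finset.sum_congr rfl fun Q hQ => ?_
  rw [Finset.mem_powerset] at hQ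
  have hprod : ∏ j ∈ S.erase a, (if j ∈ insert a Q then w j else 1 - w j) = ∏ j ∈ S.erase a, (if j ∈ Q then w j else 1 - w j) := by
    refine Finset.prod_congr rfl fun j hj => ?_
    have hja : j ≠ a := Finset.ne_of_mem_erase hj
    simp [Finset.mem_insert, hja]
  simp only [patW]
  rw [Finset.prod_insert hna, if_pos (Finset.mem_insert_self a Q), hprod, hwa, one_mul]

/-- The companions of the distinguished index `a < K`, nearest first on each side: left `a−1, …, 0`, right `a+1, …, K−1`. [this work] -/
def leftIdx (a : ℕ) : List ℕ := (List.range a).reverse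
/-- Right companions `a+1, …, K−1`. [this work] -/
def rightIdx (K a : ℕ) : List ℕ := List.range' (a + 1) (K - 1 - a)

/-- The two companion lists enumerate `range K ∖ a` without repetition. [this work] -/
theorem leftIdx_append_rightIdx {K a : ℕ} (ha : a < K) :
    (leftIdx a ++ rightIdx K a).Nodup ∧ (leftIdx a ++ rightIdx K a).toFinset = (Finset.range K).erase a := by
  constructor
  · rw [List.nodup_append]
    refine ⟨List.nodup_reverse.mpr (List.nodup_range), List.nodup_range', ?_⟩
    intro j hj k hk
    simp only [leftIdx, List.mem_reverse, List.mem_range] at hj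
    simp only [rightIdx, List.mem_range'_1] at hk
    omega
  · ext j
    simp only [List.toFinset_append, Finset.mem_union, List.mem_toFinset, leftIdx, rightIdx, List.mem_reverse, List.mem_range,
      List.mem_range'_1, Finset.mem_erase, Finset.mem_range]
    omega

/-- **(D0), pattern side.**  For hair weights `w` with `w a = 1` (`a < K`) and any function `G` of the set of open hairs,
`Σ_{Q ⊆ range K} patW (range K) w Q · G Q = expect2 fL fR (leftIdx a) (rightIdx K a) (fun Q_L Q_R => G (insert a (Q_L ++ Q_R).toFinset))`
for any companion data `fL`, `fR` carrying the hair weights (`(fL k).h = w k` on the left indices, `(fR k).h = w k` on the right ones). [this work] -/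
theorem sum_patW_range_eq_expect2 {K a : ℕ} (ha : a < K) (w : ℕ → ℝ) (hwa : w a = 1) (G : Finset ℕ → ℝ)
    (fL fR : ℕ → HComp) (hL : ∀ k ∈ leftIdx a, (fL k).h = w k) (hR : ∀ k ∈ rightIdx K a, (fR k).h = w k) :
    ∑ Q ∈ (Finset.range K).powerset, patW (Finset.range K) w Q * G Q
      = expect2 fL fR (leftIdx a) (rightIdx K a) (fun QL QR => G (insert a (QL ++ QR).toFinset)) := by
  classical
  obtain ⟨hnd, hset⟩ := leftIdx_append_rightIdx ha
  rw [sum_patW_sure _ _ _ (Finset.mem_range.mpr ha) hwa, ← hset]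
  -- one data function carrying all hair weights
  let f : ℕ → HComp := fun k => if k < a then fL k else fR k
  have hf : ∀ k ∈ leftIdx a ++ rightIdx K a, (f k).h = w k := by
    intro k hk
    rcases List.mem_append.mp hk with hk | hk
    · have : k < a := by simp only [leftIdx, List.mem_reverse, List.mem_range] at hk; exact hk
      simp only [f, if_pos this]; exact hL k hk
    · have : ¬ k < a := by simp only [rightIdx, List.mem_range'_1] at hk; omega
      simp only [f, if_neg this]; exact hR k hk
  rw [sum_patW_eq_expect f w (fun Q => G (insert a Q)) _ hnd hf, expect_append]
  unfold expect2
  have hfL : ∀ k ∈ leftIdx a, (f k).h = (fL k).h := by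
    intro k hk
    have : k < a := by simp only [leftIdx, List.mem_reverse, List.mem_range] at hk; exact hk
    simp only [f, if_pos this]
  have hfR : ∀ k ∈ rightIdx K a, (f k).h = (fR k).h := by
    intro k hk
    have : ¬ k < a := by simp only [rightIdx, List.mem_range'_1] at hk; omega
    simp only [f, if_neg this]
  rw [expect_congr hfL]
  congr 1
  funext QL
  rw [expect_congr hfR]

end TwoArc

end Quant

end Summit.CriticalPhenomena.PercolationContinuityZ3.Theorems
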